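import Mathlib
import HarnessLib
import Summits.Ventures.LatticeQCDFlow.Exactness.SphereLuscherTrivializationMeasure

/-!
# The evolution maps of Lüscher's time-dependent flow as bijections of the lattice of site spheres, and Lüscher's theorem as `(Φ_{0→c})_*π̄ = π̄.tilted(−cS)` on `Ω` itself

HONEST FRAMING: exact (Metropolis-corrected) sampling algorithms for lattice gauge theory;
figures of merit are autocorrelation/cost numbers at stated couplings and volumes; no
continuum-physics claim.

Venture `LatticeQCDFlow` (cell pub-lqcd), topic `Exactness`; FANOUT row 7 (`s0-cpn-null`).  NEW WORK
of the cell over the tree's `Exactness/SphereTimeDependentFlow.lean` (this leg: the ambient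
evolution maps `sphereTDFlow hG T t₀ t` conserve every site norm, Chapman–Kolmogorov, continuity),
`Exactness/SphereLuscherTrivialization.lean` (Lüscher's theorem, weak form) and
`Exactness/SphereLuscherTrivializationMeasure.lean` (probability measures on `Ω` are determined by
the `C¹` ambient functionals); nothing is cited as a fact.  Printed counterpart, NAMED ONLY:
M. Lüscher, Commun. Math. Phys. 293 (2010) 899, §3: the trivializing map is a bijection of field
space transporting the a-priori measure to `e^{−S}`.

* §1 **`sphereTDFlowMap hG T t₀ t : (Λ → S(E)) → (Λ → S(E))`** (definition): the evolution map read
  on sphere configurations; `Φ_{t₀→t₀} = id`, Chapman–Kolmogorov, the bijection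
  **`sphereTDFlowEquiv`** with inverse `Φ_{t→t₀}`, continuity, measurability.
* §2 **LÜSCHER'S THEOREM ON `Ω` ITSELF** (**`map_sphereTDFlowMap_eq_tilted`**): if the jointly `C²`
  generator solves `𝓛_sG_s = S + C_s` on `Ω` for `s ∈ [0, c]` (`S ∈ C¹`, `c ≥ 0`), then
  `(sphereTDFlowMap hG c 0 c)_*π̄ = π̄.tilted(−cS)` — the push-forward of the a-priori product
  measure by the evolution map IS the tilted probability measure `e^{−cS}π̄/Z_c`, as measures on the
  product of spheres.

NOT CLAIMED: existence of exact solutions of the flow equation; the Jacobian; anything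
quantitative.
-/

noncomputable section

namespace Summit.Ventures.LatticeQCDFlow.Exactness

open Function Set Metric MeasureTheory NormedSpace InnerProductSpace
open scoped RealInnerProductSpace Topology

variable {Λ : Type*} {E : Type*} [NormedAddCommGroup E] [InnerProductSpace ℝ E]
  [FiniteDimensional ℝ E] [Fintype Λ] [DecidableEq Λ] {G : ℝ → (Λ → E) → ℝ} {T : ℝ}

/-! ## §1 The evolution maps on sphere configurations -/

section Map

/-- **The evolution map on sphere configurations** `Φ_{t₀→t} : (Λ → S(E)) → (Λ → S(E))` of Lüscher's
time-dependent flow (horizon `T`): the ambient evolution map, which conserves every site norm. -/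
def sphereTDFlowMap (hG : ContDiff ℝ 2 fun q : ℝ × (Λ → E) => G q.1 q.2) (T t₀ t : ℝ)
    (ω : Λ → sphere (0 : E) 1) : Λ → sphere (0 : E) 1 :=
  fun n => ⟨sphereTDFlow hG T t₀ t (fun m => (ω m : E)) n, by
    rw [mem_sphere_zero_iff_norm]
    exact norm_sphereTDFlow_eq_one hG t₀ (fun m => by simp) t n⟩

/-- The evolution map read in the ambient space. -/
@[simp]
theorem coe_sphereTDFlowMap (hG : ContDiff ℝ 2 fun q : ℝ × (Λ → E) => G q.1 q.2) (T t₀ t : ℝ)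
    (ω : Λ → sphere (0 : E) 1) (n : Λ) :
    ((sphereTDFlowMap hG T t₀ t ω n : sphere (0 : E) 1) : E) =
      sphereTDFlow hG T t₀ t (fun m => (ω m : E)) n :=
  rfl

/-- The evolution map read in the ambient space, as a configuration. -/
theorem coe_sphereTDFlowMap_eq (hG : ContDiff ℝ 2 fun q : ℝ × (Λ → E) => G q.1 q.2) (T t₀ t : ℝ)
    (ω : Λ → sphere (0 : E) 1) :
    (fun n => ((sphereTDFlowMap hG T t₀ t ω n : sphere (0 : E) 1) : E)) =
      sphereTDFlow hG T t₀ t (fun m => (ω m : E)) :=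
  rfl

/-- `Φ_{t₀→t₀} = id`. -/
theorem sphereTDFlowMap_self (hG : ContDiff ℝ 2 fun q : ℝ × (Λ → E) => G q.1 q.2) (T t₀ : ℝ)
    (ω : Λ → sphere (0 : E) 1) : sphereTDFlowMap hG T t₀ t₀ ω = ω := by
  funext n
  ext
  simp

/-- **Chapman–Kolmogorov** on sphere configurations: `Φ_{t₁→t₂} ∘ Φ_{t₀→t₁} = Φ_{t₀→t₂}`. -/
theorem sphereTDFlowMap_trans (hG : ContDiff ℝ 2 fun q : ℝ × (Λ → E) => G q.1 q.2) (T t₀ t₁ t₂ : ℝ)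
    (ω : Λ → sphere (0 : E) 1) :
    sphereTDFlowMap hG T t₁ t₂ (sphereTDFlowMap hG T t₀ t₁ ω) = sphereTDFlowMap hG T t₀ t₂ ω := by
  funext n
  ext
  show sphereTDFlow hG T t₁ t₂ (sphereTDFlow hG T t₀ t₁ (fun m => (ω m : E))) n =
    sphereTDFlow hG T t₀ t₂ (fun m => (ω m : E)) n
  rw [sphereTDFlow_trans]

/-- **The evolution maps are bijections of `Λ → S(E)`**, `Φ_{t→t₀}` inverting `Φ_{t₀→t}`. -/
def sphereTDFlowEquiv (hG : ContDiff ℝ 2 fun q : ℝ × (Λ → E) => G q.1 q.2) (T t₀ t : ℝ) :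
    (Λ → sphere (0 : E) 1) ≃ (Λ → sphere (0 : E) 1) where
  toFun := sphereTDFlowMap hG T t₀ t
  invFun := sphereTDFlowMap hG T t t₀
  left_inv ω := by rw [sphereTDFlowMap_trans, sphereTDFlowMap_self]
  right_inv ω := by rw [sphereTDFlowMap_trans, sphereTDFlowMap_self]

/-- **The evolution maps are continuous** on sphere configurations. -/
theorem continuous_sphereTDFlowMap (hG : ContDiff ℝ 2 fun q : ℝ × (Λ → E) => G q.1 q.2)
    (T t₀ t : ℝ) : Continuous (sphereTDFlowMap hG T t₀ t) := by
  refine continuous_pi fun n => Continuous.subtype_mk ?_ _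
  exact (continuous_apply n).comp
    ((contDiff_sphereTDFlow_apply hG t₀ t).continuous.comp continuous_sphereConfig)

variable [MeasurableSpace E] [BorelSpace E]

/-- … hence measurable. -/
theorem measurable_sphereTDFlowMap (hG : ContDiff ℝ 2 fun q : ℝ × (Λ → E) => G q.1 q.2)
    (T t₀ t : ℝ) : Measurable (sphereTDFlowMap hG T t₀ t) :=
  (continuous_sphereTDFlowMap hG T t₀ t).measurable

end Map

/-! ## §2 Lüscher's theorem on `Ω` itself -/

section Luscher

variable [MeasurableSpace E] [BorelSpace E] [Nontrivial E]

/-- **LÜSCHER'S THEOREM AS AN EQUALITY OF MEASURES ON THE PRODUCT OF SPHERES.**  Let `S ∈ C¹`, `G`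
jointly `C²`, `0 ≤ c`.  If `𝓛_sG_s = S + C_s` on `Ω` for every `s ∈ [0, c]`, then
`(sphereTDFlowMap hG c 0 c)_*π̄ = π̄.tilted(−cS)`: the evolution map of Lüscher's flow from time `0`
to time `c` pushes the a-priori product measure forward to the tilted probability measure
`e^{−cS}π̄/Z_c`. -/
theorem map_sphereTDFlowMap_eq_tilted {S : (Λ → E) → ℝ} (hS : ContDiff ℝ 1 S)
    (hG : ContDiff ℝ 2 fun q : ℝ × (Λ → E) => G q.1 q.2) {c : ℝ} (hc : 0 ≤ c) {C : ℝ → ℝ}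
    (hsol : ∀ s ∈ Icc 0 c, ∀ ω : Λ → sphere (0 : E) 1,
      sphereLuscherL S s (G s) (fun m => (ω m : E)) = S (fun m => (ω m : E)) + C s) :
    Measure.map (sphereTDFlowMap hG c 0 c) (Measure.pi (fun _ : Λ => uniformSphere (volume : Measure E))) =
      (Measure.pi (fun _ : Λ => uniformSphere (volume : Measure E))).tilted
        (fun ω : Λ → sphere (0 : E) 1 => -(c * S (fun m => (ω m : E)))) := by
  haveI := isProbabilityMeasure_tilted_neg_action (Λ := Λ) hS.continuous c
  haveI : IsProbabilityMeasure (Measure.map (sphereTDFlowMap hG c 0 c)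
      (Measure.pi (fun _ : Λ => uniformSphere (volume : Measure E)))) :=
    Measure.isProbabilityMeasure_map (measurable_sphereTDFlowMap hG c 0 c).aemeasurable
  refine measure_sphereConfig_ext_of_forall_integral_contDiff_eq fun H hH => ?_
  have hcH : Continuous fun ω : Λ → sphere (0 : E) 1 => H (fun n => (ω n : E)) :=
    hH.continuous.comp continuous_sphereConfig
  rw [integral_map (measurable_sphereTDFlowMap hG c 0 c).aemeasurable hcH.aestronglyMeasurable]
  simp only [coe_sphereTDFlowMap]
  exact luscher_trivialization_tilted hS hG hH hc hsol

end Luscher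

end Summit.Ventures.LatticeQCDFlow.Exactness

end
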